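import Summits.BirchSwinnertonDyer.Rank1Residual.Additive.KatoDescentRankOneCountOfH2Count
import Summits.BirchSwinnertonDyer.BirchSwinnertonDyer.Theorems.KatoDescentPotSupersingularTowerTorsionFiniteImai
import Literature.NumberTheory.EllipticCurves.Kato2004.IwasawaInvolutionTwistProofs
import HarnessLib

set_option autoImplicit false

/-!
# J-MATCHING: every (H2ᶜ)-pinned package `J` and every package `J₀ ⊇ (X₀)_γ` of finite cokernel (the package of H2X /
# H2X⁺) over the same pin `I` have `#(J.H2)_Γ = #(J₀.H2)_Γ`; so COUNT-H2 ⟺ COUNT-X₀ := «`KatoH2CountAt W p #(J₀.H2)_Γ` for the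
# `X₀`-containing package» modulo {GZK, `thm12_4`, H2X} (seat `bsd-cm-prr-ty1` g13, cell `bsd-cm`; theorems only: no definition,
# no named fact, no instance, no `sorry`)

Part 34 of the seat's kernel cut of stub 3 `stub_rankOneCountReadingKato` of the Kato–Perrin-Riou skeletons v4 (cruxes
stmt-BirchSwinnertonDyer-19945 / -19223); successor row (s1) of planner D535 (2).  Part 32 left ONE count-side input on the
all-additive rows, the display COUNT-H2 «for every (H2ᶜ)-pinned `J : Kato2004.IwasawaH2Data W p κ γ I`, `KatoH2CountAt W p
#(J.H2)_Γ`», and recorded that a rank-one H2X⁺ speaks only for ITS OWN package — the `J₀` carrying an injective `Λ`-linear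
`e₀ : (W.fineSelmerDualData κ hγ).X → J₀.H2` of finite cokernel (the text of the named facts
`Kato2004.exists_iwasawaH2Data_fineSelmerDual_embedding` = H2X, p624791, and `…_count` = H2X⁺, p676034, whose count clause is
guarded by `Finite W(ℚ)`).  THIS FILE matches the two currencies:
* §1 algebra of the Iwasawa involution `ι` on `Γ`-coinvariants: `ι T = T·(−1 − ι T)`, so an `ι`-semilinear additive equivalence
  `e : M ≃+ N` (`e (f • m) = ι f • e m`, "`N = M^ι`") carries `T·M` onto `T·N` (`map_TSubmodule_eq_of_involSemilinear`) and
  **`#N_Γ = #M_Γ`** (`natCard_coinvariants_eq_of_involSemilinear`, `finite_coinvariants_of_involSemilinear`) — the count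
  `#(·)_Γ` is `ι`-INSENSITIVE (CONVENTION Q verdict §2: "invisible to every layer-0 count").
* §2 J-MATCHING over one pin `I` (any `W/ℚ`, any `p`, any `(κ, γ)` with `γ` a topological generator; no row hypothesis):
  `lengthAt_H2_eq_of_embedding` (`J₀ ⊇ (X₀)_γ` of finite cokernel ⟹ `ℓ_𝔮(J₀.H2) = ℓ_𝔮((X₀)_γ)` at height ≤ 1 — H2X's
  `lengthAt_eq_of_injective_of_finite_quotient`); `exists_involTwist_lengthAt_eq_of_pinned_contra` (a package pinned against the
  key-`γ⁻¹` data has an `ι`-twin `J^ι` over the SAME `I` pinned against `(X₀)_γ`: g6 `IwasawaH2Data.exists_involTwist` +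
  `fineSelmerDualData_lengthAt_inv_eq`); `exists_involTwist_pinned_contra_of_embedding` (`J₀^ι` is (H2ᶜ)-pinned);
  **`natCard_coinvariants_H2_eq_of_pinned_of_embedding`**: for `J` (H2ᶜ)-pinned and `(J₀, e₀)` as above, both `(·)_Γ` finite,
  **`#(J.H2)_Γ = #(J₀.H2)_Γ`** — E9's J-elimination `#(·.H2)_Γ · #((X₀)_γ)^Γ = #desc(I) · #((X₀)_γ)_Γ` on `J^ι` and on `J₀`,
  cancellation of the finite `#((X₀)_γ)^Γ`, and §1 for `J ↔ J^ι`; `katoH2CountAt_iff_of_pinned_of_embedding`.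
* §3 the display **COUNT-X₀** := «on every all-additive rank-one row (COUNT-H2's binders, `hγ` named), for every `I`, every
  `J₀ : IwasawaH2Data W p κ γ I` and every injective `e₀ : (W.fineSelmerDualData κ hγ).X →ₗ[Λ] J₀.H2` of finite cokernel:
  `KatoH2CountAt W p #(J₀.H2)_Γ`» — VERBATIM the count clause of H2X⁺ for the `X₀`-containing package, asked in rank one (where
  `Sel_str` is finite by Part 31b) instead of under `Finite W(ℚ)`; **`countH2_of_gzk_of_thm12_4_of_h2x_of_countX₀`**
  ({GZK, `thm12_4`, H2X} + COUNT-X₀ ⟹ COUNT-H2: H2X supplies `(J₀, e₀)` over the given `I` — its finiteness hypothesis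
  `W(ℚ_{p,∞})[p^∞]` finite is the tree THEOREM `TowerTorsionFiniteOrdinary.finite_fixedPoints_kerSubgroup_inf_decomp` under
  `0 ≤ v_p(j)` (Imai 1975, p686208) —, `thm12_4` + GZK make both `(·)_Γ` finite, §2 transfers the count) and
  **`countX₀_of_gzk_of_thm12_4_of_countH2`** ({GZK, `thm12_4`} + COUNT-H2 ⟹ COUNT-X₀, through the (H2ᶜ)-pinned twin `J₀^ι`).
So, modulo {GZK, `thm12_4`, H2X}, COUNT-H2 ⟺ COUNT-X₀ on the all-additive rows, and the count-side residual of stub 3 is the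
ONE printed statement (14.14.2) + (14.9.3) for Kato's `X₀`-containing `𝐇²`-package in rank one — nothing about "other" packages.
HONEST LABEL: theorems only; no stub or item is closed; nothing is registered; nothing is asserted on 19945 / 19223; H2X is a
hypothesis (named fact of the tree, not proved here); Kato's Main Conjecture and Perrin-Riou's conjecture are not touched; BSD
is not proved for any curve.  References: [Kato2004Asterisque] §12.2 (p. 220), Thm. 12.4 (p. 221), §13.8 (p. 228), (14.9.1)
(p. 239), (14.9.3) (p. 240), §14.14 (14.14.1)–(14.14.2) (p. 243), Lemma 14.15, Prop. 14.16 (p. 244), (17.13.1) (p. 279);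
[GreenbergLNM1716] §1 p. 60, §4 Lemma 4.2; [Greenberg1989] §0 pp. 101–102; [Washington1997] §13.2; [Imai1975] Theorem (p. 12);
[NeukirchSchmidtWingberg2008] (5.1.4) Remark 4.
-/

noncomputable section

open scoped Classical NumberField ContRepresentation

open WeierstrassCurve Field IsDedekindDomain NumberField CategoryTheory Literature.NumberTheory.EllipticCurves
  Literature.NumberTheory.EllipticCurves.Kato2004 Literature.NumberTheory.GaloisRepresentations
  Literature.NumberTheory.GaloisRepresentations.DiscreteGaloisModule Literature.NumberTheory.EllipticCurves.Kato2004.EulerSystemValues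
  Literature.NumberTheory.EllipticCurves.IwasawaAlgebra Literature.NumberTheory.EllipticCurves.Rank1Residual
open WeierstrassCurve (galH1Primary kummerMapTorsion)
open Summit.BirchSwinnertonDyer.Rank1Residual.X12.O11 Summit.BirchSwinnertonDyer.Rank1Residual
  Summit.BirchSwinnertonDyer.Rank1Residual.Additive.GlobalKummer
  Summit.BirchSwinnertonDyer.BirchSwinnertonDyer.Theorems.CongruentShaFreeCutKatoKummerLogTorsion
  Summit.BirchSwinnertonDyer.BirchSwinnertonDyer.Theorems.CongruentShaFreeCutKatoDescentDatumOfH2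

namespace Summit.BirchSwinnertonDyer.Rank1Residual.Additive.StrictCount

/-! ## §1 The count `#M_Γ` is `ι`-insensitive: transport of `T·M` and of `M/T·M` along an `ι`-semilinear equivalence -/

section Invol

variable {p : ℕ} [Fact p.Prime]
  {M : Type*} [AddCommGroup M] [Module (IwasawaAlgebra p) M]
  {N : Type*} [AddCommGroup N] [Module (IwasawaAlgebra p) N]

/-- **`ι T = T · (−1 − ι T)`** in `Λ` (from `T + ι T + ι T · T = 0`): the ideals `(ι T)` and `(T)` coincide.
[cite: Washington1997, §13.2] -/
theorem invol_X_eq_X_mul :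
    invol p (PowerSeries.X : IwasawaAlgebra p) = PowerSeries.X * (-1 - invol p PowerSeries.X) := by
  have h := X_add_invol_X_add_mul (p := p)
  linear_combination h

/-- **An `ι`-semilinear additive equivalence carries `T·M` onto `T·N`** (`e (T y) = ι T · e y = T · ((−1 − ι T) e y)` and
symmetrically with `ι ι = id`). [cite: Washington1997, §13.2] [cite: GreenbergLNM1716, §1 p. 60] -/
theorem map_TSubmodule_eq_of_involSemilinear (e : M ≃+ N)
    (he : ∀ (f : IwasawaAlgebra p) (m : M), e (f • m) = invol p f • e m) :
    (TSubmodule p M).toAddSubgroup.map (e : M →+ N) = (TSubmodule p N).toAddSubgroup := by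
  ext n
  simp only [AddSubgroup.mem_map, Submodule.mem_toAddSubgroup, mem_TSubmodule_iff, AddMonoidHom.coe_coe]
  constructor
  · rintro ⟨m, ⟨y, rfl⟩, rfl⟩
    refine ⟨(-1 - invol p PowerSeries.X) • e y, ?_⟩
    rw [he]
    conv_rhs => rw [invol_X_eq_X_mul, mul_smul]
  · rintro ⟨y, rfl⟩
    refine ⟨invol p PowerSeries.X • e.symm y, ⟨(-1 - invol p PowerSeries.X) • e.symm y, ?_⟩, ?_⟩
    · rw [← mul_smul, ← invol_X_eq_X_mul]
    · rw [he, invol_invol, e.apply_symm_apply]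

/-- **`#N_Γ = #M_Γ` for `N = M^ι`**: the induced additive equivalence `M/T·M ≃+ N/T·N`.  So the order of the
`Γ`-coinvariants does not see the keying `M` vs `M^ι` (CONVENTION Q verdict §2). [cite: GreenbergLNM1716, §1 p. 60]
[cite: Washington1997, §13.2] -/
theorem natCard_coinvariants_eq_of_involSemilinear (e : M ≃+ N)
    (he : ∀ (f : IwasawaAlgebra p) (m : M), e (f • m) = invol p f • e m) :
    Nat.card (coinvariants p N) = Nat.card (coinvariants p M) :=
  (Nat.card_congr (QuotientAddGroup.congr (TSubmodule p M).toAddSubgroup (TSubmodule p N).toAddSubgroup e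
    (map_TSubmodule_eq_of_involSemilinear e he)).toEquiv).symm

/-- `M_Γ` finite ⟹ `(M^ι)_Γ` finite. [cite: GreenbergLNM1716, §1 p. 60] -/
theorem finite_coinvariants_of_involSemilinear (e : M ≃+ N)
    (he : ∀ (f : IwasawaAlgebra p) (m : M), e (f • m) = invol p f • e m) [Finite (coinvariants p M)] :
    Finite (coinvariants p N) :=
  have E : coinvariants p M ≃ coinvariants p N :=
    (QuotientAddGroup.congr (TSubmodule p M).toAddSubgroup (TSubmodule p N).toAddSubgroup e
      (map_TSubmodule_eq_of_involSemilinear e he)).toEquiv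
  Finite.of_equiv _ E

end Invol

/-! ## §2 J-matching over one pin `I`: `#(J.H2)_Γ = #(J₀.H2)_Γ` for `J` (H2ᶜ)-pinned and `J₀ ⊇ (X₀)_γ` of finite cokernel -/

section JMatch

open Summit.BirchSwinnertonDyer.Rank1Residual.Additive.LocPKummer

variable (W : WeierstrassCurve ℚ) [W.IsElliptic] (p : ℕ) [Fact p.Prime] [ContinuousSMul ℤ_[p] (W.tateModule p)]
  {κ : ZpExtension ℚ p} {γ : absoluteGaloisGroup ℚ}

/-- **`J₀ ⊇ (X₀)_γ` with finite cokernel ⟹ `ℓ_𝔮(J₀.H2) = ℓ_𝔮((X₀)_γ)` at every prime of height `≤ 1`** (H2X's algebra lemma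
`lengthAt_eq_of_injective_of_finite_quotient`: an injection of finite cokernel is a pseudo-isomorphism); `(X₀)_γ =
(W.fineSelmerDualData κ hγ).X` is the key-`γ` dual fine Selmer datum of H2X's text. [cite: Kato2004Asterisque, (14.9.1) (p. 239)]
[cite: NeukirchSchmidtWingberg2008, Ch. V §1, (5.1.4) Remark 4] -/
theorem lengthAt_H2_eq_of_embedding (hγ : κ.IsTopGenerator γ) {I : IwasawaH1Data W p κ γ} (J₀ : IwasawaH2Data W p κ γ I)
    (e₀ : (W.fineSelmerDualData κ hγ).X →ₗ[IwasawaAlgebra p] J₀.H2) (he₀ : Function.Injective e₀)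
    (hfin₀ : Finite (J₀.H2 ⧸ LinearMap.range e₀))
    (𝔮 : PrimeSpectrum (IwasawaAlgebra p)) (h𝔮 : 𝔮.asIdeal.height ≤ 1) :
    Module.lengthAt (IwasawaAlgebra p) J₀.H2 𝔮 = Module.lengthAt (IwasawaAlgebra p) (W.fineSelmerDualData κ hγ).X 𝔮 :=
  (lengthAt_eq_of_injective_of_finite_quotient e₀ he₀ hfin₀ 𝔮 h𝔮).symm

/-- **A (H2ᶜ)-pinned package has an `ι`-twin over the SAME pin, pinned against `(X₀)_γ`.**  If `ℓ_𝔮(J.H2) = ℓ_𝔮(Y.X)` at every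
height-one `𝔮` for every dual fine Selmer datum `Y` of key `γ⁻¹` (the (H2ᶜ) pin of COUNT-H2), then the twist `J^ι`
(`IwasawaH2Data.exists_involTwist`: an `ι`-semilinear `e : J.H2 ≃+ J'.H2` with `ℓ_𝔮(J'.H2) = ℓ_{ι𝔮}(J.H2)`) has `ℓ_𝔮(J'.H2) =
ℓ_{ι𝔮}(Y.X) = ℓ_𝔮((X₀)_γ)` (`fineSelmerDualData_lengthAt_inv_eq`, `ι ι = id`; a key-`γ⁻¹` datum exists as the twist of `(X₀)_γ`).
[cite: Kato2004Asterisque, §12.2 (12.2.1) (p. 220), Thm. 12.4 (1) (p. 221), §14.14 (14.14.1) (p. 243)] [cite: Greenberg1989, §0 pp. 101–102] -/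
theorem exists_involTwist_lengthAt_eq_of_pinned_contra (hγ : κ.IsTopGenerator γ) {I : IwasawaH1Data W p κ γ}
    (J : IwasawaH2Data W p κ γ I)
    (hpin : ∀ (Y : W.FineSelmerDualData κ γ⁻¹) (𝔮 : PrimeSpectrum (IwasawaAlgebra p)), 𝔮.asIdeal.height = 1 →
      Module.lengthAt (IwasawaAlgebra p) J.H2 𝔮 = Module.lengthAt (IwasawaAlgebra p) Y.X 𝔮) :
    ∃ (J' : IwasawaH2Data W p κ γ I) (e : J.H2 ≃+ J'.H2),
      (∀ (f : IwasawaAlgebra p) (x : J.H2), e (f • x) = invol p f • e x) ∧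
      ∀ 𝔮 : PrimeSpectrum (IwasawaAlgebra p), 𝔮.asIdeal.height = 1 →
        Module.lengthAt (IwasawaAlgebra p) J'.H2 𝔮 = Module.lengthAt (IwasawaAlgebra p) (W.fineSelmerDualData κ hγ).X 𝔮 := by
  obtain ⟨Y, -, -, -⟩ := fineSelmerDualData_exists_involTwist (mul_inv_cancel γ) (W.fineSelmerDualData κ hγ)
  obtain ⟨J', e, he, hlen⟩ := J.exists_involTwist
  refine ⟨J', e, he, fun 𝔮 h𝔮 => ?_⟩
  have h𝔮' : (PrimeSpectrum.comap (invol p).toRingHom 𝔮).asIdeal.height = 1 := by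
    rw [height_comap_invol, h𝔮]
  rw [hlen 𝔮, hpin Y _ h𝔮', fineSelmerDualData_lengthAt_inv_eq (W.fineSelmerDualData κ hγ) Y, comap_invol_comap_invol]

/-- **The `ι`-twin `J₀^ι` of an `X₀`-containing package is (H2ᶜ)-pinned** (over the same `I`): `ℓ_𝔮(J₀^ι.H2) = ℓ_{ι𝔮}(J₀.H2) =
ℓ_{ι𝔮}((X₀)_γ) = ℓ_𝔮(Y.X)` for every `Y` of key `γ⁻¹` — the computation of g6's `….lengthAt_eq_contra`, here for a GIVEN `J₀`.
[cite: Kato2004Asterisque, (14.9.1) (p. 239), §12.2 (12.2.3) (p. 220), (14.14.1) (p. 243), (17.13.1) (p. 279)] [cite: Greenberg1989, §0 pp. 101–102] -/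
theorem exists_involTwist_pinned_contra_of_embedding (hγ : κ.IsTopGenerator γ) {I : IwasawaH1Data W p κ γ}
    (J₀ : IwasawaH2Data W p κ γ I) (e₀ : (W.fineSelmerDualData κ hγ).X →ₗ[IwasawaAlgebra p] J₀.H2)
    (he₀ : Function.Injective e₀) (hfin₀ : Finite (J₀.H2 ⧸ LinearMap.range e₀)) :
    ∃ (J : IwasawaH2Data W p κ γ I) (e : J₀.H2 ≃+ J.H2),
      (∀ (f : IwasawaAlgebra p) (x : J₀.H2), e (f • x) = invol p f • e x) ∧
      ∀ (Y : W.FineSelmerDualData κ γ⁻¹) (𝔮 : PrimeSpectrum (IwasawaAlgebra p)), 𝔮.asIdeal.height = 1 →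
        Module.lengthAt (IwasawaAlgebra p) J.H2 𝔮 = Module.lengthAt (IwasawaAlgebra p) Y.X 𝔮 := by
  obtain ⟨J, e, he, hlen⟩ := J₀.exists_involTwist
  refine ⟨J, e, he, fun Y 𝔮 h𝔮 => ?_⟩
  have h𝔮' : (PrimeSpectrum.comap (invol p).toRingHom 𝔮).asIdeal.height ≤ 1 := by
    rw [height_comap_invol, h𝔮]
  rw [hlen 𝔮, lengthAt_H2_eq_of_embedding W p hγ J₀ e₀ he₀ hfin₀ _ h𝔮',
    ← fineSelmerDualData_lengthAt_inv_eq (W.fineSelmerDualData κ hγ) Y 𝔮]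

/-- **J-MATCHING.**  Over one pin `I : IwasawaH1Data W p κ γ` (any `W/ℚ`, any `p`, `γ` a topological generator of the
`ℤ_p`-extension `κ`): let `J` be a package with the (H2ᶜ) pin of COUNT-H2 (`ℓ_𝔮(J.H2) = ℓ_𝔮(Y.X)` at height one for every
dual fine Selmer datum `Y` of key `γ⁻¹`) and `(J₀, e₀)` a package with an injective `Λ`-linear `e₀ : (X₀)_γ → J₀.H2` of finite
cokernel (the text of H2X / H2X⁺); if `(J.H2)_Γ` and `(J₀.H2)_Γ` are finite then **`#(J.H2)_Γ = #(J₀.H2)_Γ`**.  Proof: the twin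
`J^ι` and `J₀` are both pinned against `(X₀)_γ` (finitely generated, `FineSelmerDualData.module_finite`), so E9's J-elimination
gives `#(J^ι.H2)_Γ · #((X₀)_γ)^Γ = #desc(I) · #((X₀)_γ)_Γ = #(J₀.H2)_Γ · #((X₀)_γ)^Γ` with `((X₀)_γ)^Γ` finite; cancel, and
`#(J.H2)_Γ = #(J^ι.H2)_Γ` (§1).  The abstract `J` of the v4 binders and the `X₀`-containing package of H2X have THE SAME
coinvariant count. [cite: Kato2004Asterisque, §14.14 (14.14.1) (p. 243) and Lemma 14.15 (p. 244)] [cite: GreenbergLNM1716, §4 Lemma 4.2 (p. 102)]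
[cite: Greenberg1989, §0 pp. 101–102] -/
theorem natCard_coinvariants_H2_eq_of_pinned_of_embedding (hγ : κ.IsTopGenerator γ) {I : IwasawaH1Data W p κ γ}
    (J : IwasawaH2Data W p κ γ I)
    (hpin : ∀ (Y : W.FineSelmerDualData κ γ⁻¹) (𝔮 : PrimeSpectrum (IwasawaAlgebra p)), 𝔮.asIdeal.height = 1 →
      Module.lengthAt (IwasawaAlgebra p) J.H2 𝔮 = Module.lengthAt (IwasawaAlgebra p) Y.X 𝔮)
    (J₀ : IwasawaH2Data W p κ γ I) (e₀ : (W.fineSelmerDualData κ hγ).X →ₗ[IwasawaAlgebra p] J₀.H2)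
    (he₀ : Function.Injective e₀) (hfin₀ : Finite (J₀.H2 ⧸ LinearMap.range e₀))
    [hJ : Finite (coinvariants p J.H2)] [hJ₀ : Finite (coinvariants p J₀.H2)] :
    Nat.card (coinvariants p J.H2) = Nat.card (coinvariants p J₀.H2) := by
  haveI : Module.Finite (IwasawaAlgebra p) (W.fineSelmerDualData κ hγ).X :=
    FineSelmerDualData.module_finite W κ hγ (W.fineSelmerDualData κ hγ)
  obtain ⟨J', e, he, hlen⟩ := exists_involTwist_lengthAt_eq_of_pinned_contra W p hγ J hpin
  haveI : Finite (coinvariants p J'.H2) := finite_coinvariants_of_involSemilinear e he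
  obtain ⟨hXinv, -, h1⟩ :=
    natCard_coinvariants_H2_mul_eq_of_lengthAt_eq W p J' (W.fineSelmerDualData κ hγ) hlen inferInstance
  obtain ⟨-, -, h2⟩ := natCard_coinvariants_H2_mul_eq_of_lengthAt_eq W p J₀ (W.fineSelmerDualData κ hγ)
    (fun 𝔮 h𝔮 => lengthAt_H2_eq_of_embedding W p hγ J₀ e₀ he₀ hfin₀ 𝔮 h𝔮.le) inferInstance
  haveI := hXinv
  have hne : Nat.card (invariants p (W.fineSelmerDualData κ hγ).X) ≠ 0 := Nat.card_pos.ne'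
  rw [← natCard_coinvariants_eq_of_involSemilinear e he]
  exact mul_right_cancel₀ hne (h1.trans h2.symm)

/-- **Hence `KatoH2CountAt W p #(J.H2)_Γ ↔ KatoH2CountAt W p #(J₀.H2)_Γ`** for `J`, `(J₀, e₀)` as in
`natCard_coinvariants_H2_eq_of_pinned_of_embedding`. [cite: Kato2004Asterisque, (14.9.3) (p. 240), §14.14 (14.14.1)–(14.14.2) (p. 243), Lemma 14.15 (p. 244)] -/
theorem katoH2CountAt_iff_of_pinned_of_embedding (hγ : κ.IsTopGenerator γ) {I : IwasawaH1Data W p κ γ}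
    (J : IwasawaH2Data W p κ γ I)
    (hpin : ∀ (Y : W.FineSelmerDualData κ γ⁻¹) (𝔮 : PrimeSpectrum (IwasawaAlgebra p)), 𝔮.asIdeal.height = 1 →
      Module.lengthAt (IwasawaAlgebra p) J.H2 𝔮 = Module.lengthAt (IwasawaAlgebra p) Y.X 𝔮)
    (J₀ : IwasawaH2Data W p κ γ I) (e₀ : (W.fineSelmerDualData κ hγ).X →ₗ[IwasawaAlgebra p] J₀.H2)
    (he₀ : Function.Injective e₀) (hfin₀ : Finite (J₀.H2 ⧸ LinearMap.range e₀))
    [Finite (coinvariants p J.H2)] [Finite (coinvariants p J₀.H2)] :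
    KatoH2CountAt W p (Nat.card (coinvariants p J.H2)) ↔ KatoH2CountAt W p (Nat.card (coinvariants p J₀.H2)) := by
  rw [natCard_coinvariants_H2_eq_of_pinned_of_embedding W p hγ J hpin J₀ e₀ he₀ hfin₀]

end JMatch

/-! ## §3 The display COUNT-X₀ and COUNT-H2 ⟺ COUNT-X₀ modulo {GZK, `thm12_4`, H2X} on the all-additive rows -/

section Displays

open Summit.BirchSwinnertonDyer.Rank1Residual.Additive.LocPKummer
  Summit.BirchSwinnertonDyer.BirchSwinnertonDyer.Theorems.TowerTorsionFiniteOrdinary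

/-- **COUNT-H2 ⟸ {GZK, `Kato2004.thm12_4`, H2X} + COUNT-X₀.**  COUNT-X₀ (hypothesis `hX₀`) is the display «on every
all-additive rank-one row (`W/ℚ` globally minimal of analytic rank one, `p` odd, `Addv W p`, `0 ≤ v_p(j)`, `p ∤ #W(ℚ)_tors`, `Ш`
finite, every bad `ℓ ≠ p` additive, `(κ, γ)` cyclotomic), for every pin `I`, every package `J₀ : IwasawaH2Data W p κ γ I` and
every injective `Λ`-linear `e₀ : (W.fineSelmerDualData κ hγ).X → J₀.H2` of finite cokernel: `KatoH2CountAt W p #(J₀.H2)_Γ`» —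
the count clause of H2X⁺ VERBATIM for the `X₀`-containing package, asked in rank one.  The conclusion is Part 32's display
COUNT-H2 VERBATIM.  Per row: GZK ⟹ rank one; `thm12_4` ⟹ `𝐇¹_Γ` f.g. torsion-free of rank one ⟹ `(J.H2)_Γ`, `(J₀.H2)_Γ` finite
(`finite_coinvariants_H2_of_iwasawaH2Data`); H2X (hypothesis `hH2X`, the tree's named fact) supplies `(J₀, e₀)` over the given
`I`, its hypothesis «`W(ℚ_{p,∞})[p^∞]` finite» being the tree theorem `finite_fixedPoints_kerSubgroup_inf_decomp` (Imai 1975)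
under `0 ≤ v_p(j)`; §2 transfers the count from `J₀` to `J`. [cite: Kato2004Asterisque, Thm. 12.4 (p. 221), (14.9.1) (p. 239),
(14.9.3) (p. 240), §14.14 (14.14.1)–(14.14.2) (p. 243), Lemma 14.15 (p. 244)] [cite: Imai1975, Theorem (p. 12)]
[cite: GreenbergLNM1716, §4 Lemma 4.2 (p. 102)] [cite: GrossZagier1986, Thm. I.7.3] -/
theorem countH2_of_gzk_of_thm12_4_of_h2x_of_countX₀ (hGZK : rank_eq_analyticRank_of_analyticRank_le_one)
    (h12 : Kato2004.thm12_4) (hH2X : exists_iwasawaH2Data_fineSelmerDual_embedding)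
    (hX₀ : ∀ (W : WeierstrassCurve ℚ) [W.IsElliptic] [W.IsGloballyMinimal] (p : ℕ) [Fact p.Prime],
      letI : ContinuousSMul ℤ_[p] (W.tateModule p) := TateModule.continuousSMul_padicInt
      ∀ (κ : ZpExtension ℚ p) (γ : absoluteGaloisGroup ℚ), κ.IsCyclotomic → (hγ : κ.IsTopGenerator γ) →
        ∀ (I : IwasawaH1Data W p κ γ) (J₀ : IwasawaH2Data W p κ γ I)
          (e₀ : (W.fineSelmerDualData κ hγ).X →ₗ[IwasawaAlgebra p] J₀.H2),
          W.analyticRank = 1 → p ≠ 2 → Addv W p → 0 ≤ padicValRat p W.j → ¬ p ∣ W.torsionOrder → Finite W.sha →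
          (∀ v ∈ W.badPlaces (𝓞 ℚ), ((Rat.HeightOneSpectrum.primesEquiv v : Nat.Primes) : ℕ) ≠ p →
            W.HasAdditiveReductionAt v) →
          Function.Injective e₀ → Finite (J₀.H2 ⧸ LinearMap.range e₀) →
          KatoH2CountAt W p (Nat.card (coinvariants p J₀.H2))) :
    ∀ (W : WeierstrassCurve ℚ) [W.IsElliptic] [W.IsGloballyMinimal] (p : ℕ) [Fact p.Prime],
      letI : ContinuousSMul ℤ_[p] (W.tateModule p) := TateModule.continuousSMul_padicInt
      ∀ (κ : ZpExtension ℚ p) (γ : absoluteGaloisGroup ℚ), κ.IsCyclotomic → κ.IsTopGenerator γ →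
        ∀ (I : IwasawaH1Data W p κ γ) (J : IwasawaH2Data W p κ γ I),
          W.analyticRank = 1 → p ≠ 2 → Addv W p → 0 ≤ padicValRat p W.j → ¬ p ∣ W.torsionOrder → Finite W.sha →
          (∀ v ∈ W.badPlaces (𝓞 ℚ), ((Rat.HeightOneSpectrum.primesEquiv v : Nat.Primes) : ℕ) ≠ p →
            W.HasAdditiveReductionAt v) →
          (∀ (Y : W.FineSelmerDualData κ γ⁻¹) (𝔮 : PrimeSpectrum (IwasawaAlgebra p)), 𝔮.asIdeal.height = 1 →
            Module.lengthAt (IwasawaAlgebra p) J.H2 𝔮 = Module.lengthAt (IwasawaAlgebra p) Y.X 𝔮) →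
          KatoH2CountAt W p (Nat.card (coinvariants p J.H2)) := by
  intro W _ _ p _
  letI : ContinuousSMul ℤ_[p] (W.tateModule p) := TateModule.continuousSMul_padicInt
  intro κ γ hκ hγ I J hr hp2 hadd hj htors hsha hall hpin
  obtain ⟨hmw, -⟩ := hGZK W (by rw [hr])
  have hrank : W.mordellWeilRank = 1 := by rw [hmw, hr]
  haveI := hsha
  have hsha' : Finite (AddCommGroup.primaryComponent W.sha p) := inferInstance
  obtain ⟨hfg, ⟨htf, hrk⟩, -⟩ := h12 W p κ γ hκ hγ I
  haveI := hfg
  haveI := htf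
  haveI : Nontrivial I.H := by
    by_contra hnt
    rw [not_nontrivial_iff_subsingleton] at hnt
    have h0 : Module.rank (IwasawaAlgebra p) I.H = 0 := rank_subsingleton' _ _
    rw [hrk] at h0
    exact one_ne_zero h0
  -- H2X's package over THIS pin; its finiteness hypothesis is Imai's theorem under `0 ≤ v_p(j)`
  have hfix := finite_fixedPoints_kerSubgroup_inf_decomp W p hj κ hκ (primePlace p) (coe_primesEquiv_primePlace p)
  obtain ⟨J₀, e₀, he₀, hfin₀⟩ := hH2X W p κ γ hγ (primePlace p) hp2 hκ (coe_primesEquiv_primePlace p) hfix I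
  haveI := finite_coinvariants_H2_of_iwasawaH2Data W p J hrank hsha'
  haveI := finite_coinvariants_H2_of_iwasawaH2Data W p J₀ hrank hsha'
  exact (katoH2CountAt_iff_of_pinned_of_embedding W p hγ J hpin J₀ e₀ he₀ hfin₀).mpr
    (hX₀ W p κ γ hκ hγ I J₀ e₀ hr hp2 hadd hj htors hsha hall he₀ hfin₀)

/-- **COUNT-X₀ ⟸ {GZK, `Kato2004.thm12_4`} + COUNT-H2** (the converse, H2X not needed): given `(J₀, e₀)` on a row, the twin
`J₀^ι` over the same `I` is (H2ᶜ)-pinned (`exists_involTwist_pinned_contra_of_embedding`), COUNT-H2 counts it, and §2 (or §1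
directly) carries the count back to `J₀`.  Hence, modulo {GZK, `thm12_4`, H2X}, COUNT-H2 ⟺ COUNT-X₀ on the all-additive rows.
[cite: Kato2004Asterisque, Thm. 12.4 (p. 221), (14.9.3) (p. 240), §14.14 (p. 243), Lemma 14.15 (p. 244)] [cite: Greenberg1989, §0 pp. 101–102] -/
theorem countX₀_of_gzk_of_thm12_4_of_countH2 (hGZK : rank_eq_analyticRank_of_analyticRank_le_one)
    (h12 : Kato2004.thm12_4)
    (hH2 : ∀ (W : WeierstrassCurve ℚ) [W.IsElliptic] [W.IsGloballyMinimal] (p : ℕ) [Fact p.Prime],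
      letI : ContinuousSMul ℤ_[p] (W.tateModule p) := TateModule.continuousSMul_padicInt
      ∀ (κ : ZpExtension ℚ p) (γ : absoluteGaloisGroup ℚ), κ.IsCyclotomic → κ.IsTopGenerator γ →
        ∀ (I : IwasawaH1Data W p κ γ) (J : IwasawaH2Data W p κ γ I),
          W.analyticRank = 1 → p ≠ 2 → Addv W p → 0 ≤ padicValRat p W.j → ¬ p ∣ W.torsionOrder → Finite W.sha →
          (∀ v ∈ W.badPlaces (𝓞 ℚ), ((Rat.HeightOneSpectrum.primesEquiv v : Nat.Primes) : ℕ) ≠ p →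
            W.HasAdditiveReductionAt v) →
          (∀ (Y : W.FineSelmerDualData κ γ⁻¹) (𝔮 : PrimeSpectrum (IwasawaAlgebra p)), 𝔮.asIdeal.height = 1 →
            Module.lengthAt (IwasawaAlgebra p) J.H2 𝔮 = Module.lengthAt (IwasawaAlgebra p) Y.X 𝔮) →
          KatoH2CountAt W p (Nat.card (coinvariants p J.H2))) :
    ∀ (W : WeierstrassCurve ℚ) [W.IsElliptic] [W.IsGloballyMinimal] (p : ℕ) [Fact p.Prime],
      letI : ContinuousSMul ℤ_[p] (W.tateModule p) := TateModule.continuousSMul_padicInt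
      ∀ (κ : ZpExtension ℚ p) (γ : absoluteGaloisGroup ℚ), κ.IsCyclotomic → (hγ : κ.IsTopGenerator γ) →
        ∀ (I : IwasawaH1Data W p κ γ) (J₀ : IwasawaH2Data W p κ γ I)
          (e₀ : (W.fineSelmerDualData κ hγ).X →ₗ[IwasawaAlgebra p] J₀.H2),
          W.analyticRank = 1 → p ≠ 2 → Addv W p → 0 ≤ padicValRat p W.j → ¬ p ∣ W.torsionOrder → Finite W.sha →
          (∀ v ∈ W.badPlaces (𝓞 ℚ), ((Rat.HeightOneSpectrum.primesEquiv v : Nat.Primes) : ℕ) ≠ p →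
            W.HasAdditiveReductionAt v) →
          Function.Injective e₀ → Finite (J₀.H2 ⧸ LinearMap.range e₀) →
          KatoH2CountAt W p (Nat.card (coinvariants p J₀.H2)) := by
  intro W _ _ p _
  letI : ContinuousSMul ℤ_[p] (W.tateModule p) := TateModule.continuousSMul_padicInt
  intro κ γ hκ hγ I J₀ e₀ hr hp2 hadd hj htors hsha hall he₀ hfin₀
  obtain ⟨hmw, -⟩ := hGZK W (by rw [hr])
  have hrank : W.mordellWeilRank = 1 := by rw [hmw, hr]
  haveI := hsha
  have hsha' : Finite (AddCommGroup.primaryComponent W.sha p) := inferInstance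
  obtain ⟨hfg, ⟨htf, hrk⟩, -⟩ := h12 W p κ γ hκ hγ I
  haveI := hfg
  haveI := htf
  haveI : Nontrivial I.H := by
    by_contra hnt
    rw [not_nontrivial_iff_subsingleton] at hnt
    have h0 : Module.rank (IwasawaAlgebra p) I.H = 0 := rank_subsingleton' _ _
    rw [hrk] at h0
    exact one_ne_zero h0
  -- the (H2ᶜ)-pinned twin `J₀^ι` over the same pin
  obtain ⟨J, -, -, hpin⟩ := exists_involTwist_pinned_contra_of_embedding W p hγ J₀ e₀ he₀ hfin₀
  haveI := finite_coinvariants_H2_of_iwasawaH2Data W p J hrank hsha'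
  haveI := finite_coinvariants_H2_of_iwasawaH2Data W p J₀ hrank hsha'
  exact (katoH2CountAt_iff_of_pinned_of_embedding W p hγ J hpin J₀ e₀ he₀ hfin₀).mp
    (hH2 W p κ γ hκ hγ I J hr hp2 hadd hj htors hsha hall hpin)

end Displays

end Summit.BirchSwinnertonDyer.Rank1Residual.Additive.StrictCount

end
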